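import Summits.CriticalPhenomena.PercolationContinuityZ3.Theorems.PercNearOneGluingNoHeavyLowerTailCondCertCond
import HarnessLib

/-!
# `NoHeavyLowerTail` (stmt-CriticalPhenomena-4575) — `COND₃`/`KN13` certificate wrapper, part 4: the literal Conjecture-1 target `KN13`

Support file (prover prim-ineq-prove-1; `--supports stmt-CriticalPhenomena-4575`).  No sorries.
`KN13 = μ(⊤)·μ(o↔b) − μ(o↔A)·μ(a₁↔b) ≥ 0` under the same hypotheses (weaker than `COND₃`, same certificate format, check `checkKB`):
`soundKN`, `kn_interior`, `kn_min_of_injective`, `kn_three_of_cert`, and `kozmaNitzan_conjecture1_card_le_three_of_kncert` —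
Kozma–Nitzan's Conjecture 1 for every `A.card ≤ 3` from a `KN13` certificate (coincident vertices: elementary or through `COND` for two relays).
[cite: KozmaNitzan2024, Conjecture 1 (p. 3)]
-/

noncomputable section

namespace Summit.CriticalPhenomena.PercolationContinuityZ3.Theorems

open MeasureTheory Set Filter Literature.Probability.Percolation
open Literature.Probability.LatticeModels (prodBernoulli)
open scoped Classical BigOperators Topology
open PatternCells CertCheck CertCells PatternSunflower

namespace CondCert

variable {n : ℕ}

/-! ## The literal Conjecture-1 target `KN13 = μ[⊤]·μ(o↔b) − μ(o↔A)·μ(a₁↔b)` (weaker than `COND₃`; same certificate format) -/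

/-- `{o ↔ b} = {0~4}`. [folklore] -/
def fOB : Formula := [[(0, 4, true)]]

/-- `C_j = {a_j ↔ b}` for a terminal index `j`. [folklore] -/
def fC (j : Fin 5) : Formula := [[(j, 4, true)]]

/-- The signed quadratic form of the `KN13` target: `+ μ(⊤)·μ(o↔b) − μ(o↔A)·μ(a₁↔b)`. [folklore] -/
def knts : List QTerm := [⟨cellsOf fTop, cellsOf fOB, 1, true⟩, ⟨cellsOf fOA, cellsOf (fC 1), 1, false⟩]

/-- The bucketed kernel check for the `KN13` target. [folklore] -/
def checkKB (C : CondCert) (nb b : ℕ) : Bool := checkTB C knts nb b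

/-- The value of the `KN13` form at the cell law: `μ(o↔b) − μ(o↔A)·μ(a₁↔b)`. [folklore] -/
theorem qval_knts (w : Sym2 (Fin n) → unitInterval) (v : Fin 5 → Fin n) :
    qval (fun m => (prodBernoulli w).real (Cell v m)) knts =
      (prodBernoulli w).real (fOB.set v) - (prodBernoulli w).real (fOA.set v) * (prodBernoulli w).real ((fC 1).set v) := by
  haveI : IsProbabilityMeasure (prodBernoulli w) := inferInstance
  have htop : (prodBernoulli w).real (fTop.set v) = 1 := by
    have : fTop.set v = (Set.univ : Set (BondConfig (Fin n))) := by
      ext ω; simp [fTop, Formula.set]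
    rw [this, probReal_univ]
  simp only [qval, knts, QTerm.val, List.map_cons, List.map_nil, List.sum_cons, List.sum_nil, ← measureReal_set_eq_linEval,
    htop, Nat.cast_one, one_mul, if_true, Bool.false_eq_true, if_false]
  ring

/-- **Soundness at the cell law for `KN13`.** [folklore] -/
theorem soundKN (C : CondCert) (hvalid : valid C = true) (hxs : C.ExtSound) {nb : ℕ} (hnb : 0 < nb) (hcheck : ∀ b < nb, checkKB C nb b = true)
    (w : Sym2 (Fin n) → unitInterval) (v : Fin 5 → Fin n)
    (h2 : (prodBernoulli w).real ((fD 2).set v) ≤ (prodBernoulli w).real ((fD 1).set v))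
    (h3 : (prodBernoulli w).real ((fD 3).set v) ≤ (prodBernoulli w).real ((fD 1).set v)) :
    0 ≤ m0tot (fun m => (prodBernoulli w).real (Cell v m)) C *
      ((prodBernoulli w).real (fOB.set v) - (prodBernoulli w).real (fOA.set v) * (prodBernoulli w).real ((fC 1).set v)) := by
  simp only [valid, hypsWithin, Bool.and_eq_true, List.all_eq_true, decide_eq_true_eq] at hvalid
  obtain ⟨hrv, ⟨⟨hl, hr⟩, hrk⟩, hlf⟩ := hvalid
  rw [← qval_knts]
  exact soundT C knts hrv hxs hnb hcheck w v (fun q hq => condHyps_holds w v h2 h3 (hl q hq))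
    (fun h hh => condHyps_holds w v h2 h3 (hr h hh)) (fun h hh => condHyps_holds w v h2 h3 (hrk h hh))
    (fun h hh => condHyps_holds w v h2 h3 (hlf h hh))

/-- **Interior weights, `KN13`.**  `μ(oA.set v) · μ(C₁.set v) ≤ μ(oB.set v)` for off-diagonal weights in `(0,1)`, `v` injective and the
two hypotheses. [folklore] -/
theorem kn_interior (C : CondCert) (hvalid : valid C = true) (hxs : C.ExtSound) {nb : ℕ} (hnb : 0 < nb)
    (hcheck : ∀ b < nb, checkKB C nb b = true) (hterm : posTerm C = true)
    (w : Sym2 (Fin n) → unitInterval)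
    (hw : ∀ e : Sym2 (Fin n), ¬ e.IsDiag → 0 < ((w e : unitInterval) : ℝ) ∧ ((w e : unitInterval) : ℝ) < 1)
    {v : Fin 5 → Fin n} (hv : Function.Injective v)
    (h2 : (prodBernoulli w).real ((fD 2).set v) ≤ (prodBernoulli w).real ((fD 1).set v))
    (h3 : (prodBernoulli w).real ((fD 3).set v) ≤ (prodBernoulli w).real ((fD 1).set v)) :
    (prodBernoulli w).real (fOA.set v) * (prodBernoulli w).real ((fC 1).set v) ≤ (prodBernoulli w).real (fOB.set v) := by
  have hM : 0 < m0tot (fun m => (prodBernoulli w).real (Cell v m)) C := m0tot_pos C hterm w hw hv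
  have h := soundKN C hvalid hxs hnb hcheck w v h2 h3
  have := nonneg_of_mul_pos_left h hM
  linarith

/-- Relabelling a one-literal connection formula `{t ↔ b}` along a map fixing `b`. [folklore] -/
theorem set_fC_comp (v : Fin 5 → Fin n) (σ : Fin 5 → Fin 5) (h4 : σ 4 = 4) (t : Fin 5) :
    (fC t).set (v ∘ σ) = (fC (σ t)).set v := by
  ext ω
  simp only [fC, mem_set_single, List.mem_singleton, forall_eq, holds_true, Function.comp_apply, h4]

/-- `oB` is fixed by the relay transpositions. [folklore] -/
theorem set_fOB_swap (v : Fin 5 → Fin n) (j : Fin 3) : fOB.set (v ∘ swapT j) = fOB.set v := by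
  obtain ⟨_, h0, h4, _, _⟩ := swapT_facts j
  ext ω
  simp only [fOB, mem_set_single, List.mem_singleton, forall_eq, holds_true, Function.comp_apply, h0, h4]

/-- **All weights, `KN13`**: for `v` injective, `μ(oA.set v) · min_j μ(C_j.set v) ≤ μ(oB.set v)`. [folklore] -/
theorem kn_min_of_injective (C : CondCert) (hvalid : valid C = true) (hxs : C.ExtSound) {nb : ℕ} (hnb : 0 < nb)
    (hcheck : ∀ b < nb, checkKB C nb b = true) (hterm : posTerm C = true)
    (w : Sym2 (Fin n) → unitInterval) {v : Fin 5 → Fin n} (hv : Function.Injective v) :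
    (prodBernoulli w).real (fOA.set v) *
        min ((prodBernoulli w).real ((fC 1).set v)) (min ((prodBernoulli w).real ((fC 2).set v)) ((prodBernoulli w).real ((fC 3).set v)))
      ≤ (prodBernoulli w).real (fOB.set v) := by
  set d : ℕ → Fin 3 → ℝ := fun k j => (prodBernoulli (mixW w k)).real ((fD (relayT j)).set v) with hd
  have hsome : ∀ k, ∃ j : Fin 3, ∀ i : Fin 3, d k i ≤ d k j := fun k =>
    Finset.exists_max_image Finset.univ (d k) Finset.univ_nonempty |>.imp fun j hj => fun i => hj.2 i (Finset.mem_univ i)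
  have hfreq : ∃ j : Fin 3, ∃ᶠ k in atTop, ∀ i : Fin 3, d k i ≤ d k j := by
    by_contra hnone
    have hnone' : ∀ j : Fin 3, ∀ᶠ k in atTop, ¬ ∀ i : Fin 3, d k i ≤ d k j := fun j =>
      Filter.not_frequently.1 (fun h => hnone ⟨j, h⟩)
    have hall : ∀ᶠ k in atTop, ∀ j : Fin 3, ¬ ∀ i : Fin 3, d k i ≤ d k j := Filter.eventually_all.2 hnone'
    obtain ⟨k, hk⟩ := hall.exists
    obtain ⟨j, hj⟩ := hsome k
    exact hk j hj
  obtain ⟨j, hj⟩ := hfreq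
  obtain ⟨hinj, h0, h4, h1, hperm⟩ := swapT_facts j
  have hvj : Function.Injective (v ∘ swapT j) := hv.comp hinj
  have hD1 : (fD 1).set (v ∘ swapT j) = (fD (relayT j)).set v := by rw [set_fD_comp v _ h4, h1]
  have hC1 : (fC 1).set (v ∘ swapT j) = (fC (relayT j)).set v := by rw [set_fC_comp v _ h4, h1]
  have hstep : ∃ᶠ k in atTop, (prodBernoulli (mixW w k)).real (fOA.set v) * (prodBernoulli (mixW w k)).real ((fC (relayT j)).set v) ≤
      (prodBernoulli (mixW w k)).real (fOB.set v) := by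
    refine hj.mono fun k hk => ?_
    have h2 : (prodBernoulli (mixW w k)).real ((fD 2).set (v ∘ swapT j)) ≤ (prodBernoulli (mixW w k)).real ((fD 1).set (v ∘ swapT j)) := by
      obtain ⟨i', hi'⟩ := hperm 1
      rw [hD1, show (fD 2 : Formula) = fD (relayT 1) from rfl, set_fD_comp v _ h4, hi']
      exact hk i'
    have h3 : (prodBernoulli (mixW w k)).real ((fD 3).set (v ∘ swapT j)) ≤ (prodBernoulli (mixW w k)).real ((fD 1).set (v ∘ swapT j)) := by
      obtain ⟨i', hi'⟩ := hperm 2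
      rw [hD1, show (fD 3 : Formula) = fD (relayT 2) from rfl, set_fD_comp v _ h4, hi']
      exact hk i'
    have := kn_interior C hvalid hxs hnb hcheck hterm (mixW w k) (fun e _ => mixW_pos_lt_one w k e) hvj h2 h3
    rwa [set_fOB_swap, set_fOA_swap, hC1] at this
  have hlim := le_of_frequently_le
    ((((stub_weightContinuity n (fOA.set v)).tendsto w).comp (tendsto_mixW w)).mul
      (((stub_weightContinuity n ((fC (relayT j)).set v)).tendsto w).comp (tendsto_mixW w)))
    (((stub_weightContinuity n (fOB.set v)).tendsto w).comp (tendsto_mixW w)) hstep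
  refine le_trans (mul_le_mul_of_nonneg_left ?_ measureReal_nonneg) hlim
  fin_cases j
  · exact min_le_left _ _
  · exact (min_le_right _ _).trans (min_le_left _ _)
  · exact (min_le_right _ _).trans (min_le_right _ _)

/-- `oB.set v = {v0 ↔ v4}`. [folklore] -/
theorem set_fOB (v : Fin 5 → Fin n) : fOB.set v = (openConn (v 0) (v 4) : Set (BondConfig (Fin n))) := by
  ext ω
  simp only [fOB, mem_set_cons, not_mem_set_nil, List.forall_mem_cons, forall_mem_nil_iff, holds_true, and_true, or_false]

/-- `(C t).set v = {v t ↔ v 4}`. [folklore] -/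
theorem set_fC (v : Fin 5 → Fin n) (t : Fin 5) : (fC t).set v = (openConn (v t) (v 4) : Set (BondConfig (Fin n))) := by
  ext ω
  simp only [fC, mem_set_cons, not_mem_set_nil, List.forall_mem_cons, forall_mem_nil_iff, holds_true, and_true, or_false]

/-- **`KN13` from a certificate, named vertices**: for pairwise distinct `o, a₁, a₂, a₃, b` and `t ≤ μ(a_j ↔ b)` (`j = 1,2,3`):
`μ({o↔a₁} ∪ {o↔a₂} ∪ {o↔a₃}) · t ≤ μ(o ↔ b)`. [cite: KozmaNitzan2024, Conjecture 1 (p. 3)] -/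
theorem kn_three_of_cert (C : CondCert) (hvalid : valid C = true) (hxs : C.ExtSound) {nb : ℕ} (hnb : 0 < nb)
    (hcheck : ∀ b < nb, checkKB C nb b = true) (hterm : posTerm C = true)
    (w : Sym2 (Fin n) → unitInterval) (o a₁ a₂ a₃ b : Fin n)
    (h01 : o ≠ a₁) (h02 : o ≠ a₂) (h03 : o ≠ a₃) (h04 : o ≠ b) (h12 : a₁ ≠ a₂) (h13 : a₁ ≠ a₃) (h14 : a₁ ≠ b)
    (h23 : a₂ ≠ a₃) (h24 : a₂ ≠ b) (h34 : a₃ ≠ b) (t : ℝ)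
    (ht1 : t ≤ (prodBernoulli w).real (openConn a₁ b)) (ht2 : t ≤ (prodBernoulli w).real (openConn a₂ b))
    (ht3 : t ≤ (prodBernoulli w).real (openConn a₃ b)) :
    (prodBernoulli w).real (openConn o a₁ ∪ openConn o a₂ ∪ openConn o a₃ : Set (BondConfig (Fin n))) * t ≤
      (prodBernoulli w).real (openConn o b) := by
  have h := kn_min_of_injective C hvalid hxs hnb hcheck hterm w (CertEG3.injective_vec5 h01 h02 h03 h04 h12 h13 h14 h23 h24 h34)
  simp only [set_fOA, set_fOB, set_fC] at h
  have htmin : t ≤ min ((prodBernoulli w).real (openConn a₁ b : Set (BondConfig (Fin n))))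
      (min ((prodBernoulli w).real (openConn a₂ b : Set (BondConfig (Fin n)))) ((prodBernoulli w).real (openConn a₃ b : Set (BondConfig (Fin n))))) :=
    le_min ht1 (le_min ht2 ht3)
  exact (mul_le_mul_of_nonneg_left htmin measureReal_nonneg).trans h

/-- **Kozma–Nitzan's Conjecture 1 (post-FKG) for every `|A| ≤ 3`, from a `KN13` certificate.**  (`|A| ≤ 2`: landed; coincident
vertices: elementary or through `COND` for two relays; five distinct vertices: the certificate.) [cite: KozmaNitzan2024, Conjecture 1 (p. 3)] -/
theorem kozmaNitzan_conjecture1_card_le_three_of_kncert (C : CondCert) (hvalid : valid C = true) (hxs : C.ExtSound) {nb : ℕ} (hnb : 0 < nb)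
    (hcheck : ∀ b < nb, checkKB C nb b = true) (hterm : posTerm C = true)
    (w : Sym2 (Fin n) → unitInterval) (A : Finset (Fin n)) (o b : Fin n) (hA : A.card ≤ 3) (t : ℝ)
    (ht : ∀ a ∈ A, t ≤ (prodBernoulli w).real (openConn a b)) :
    (prodBernoulli w).real (⋃ a ∈ A, openConn o a) * t ≤ (prodBernoulli w).real (openConn o b) := by
  haveI : IsProbabilityMeasure (prodBernoulli w) := inferInstance
  set μ := prodBernoulli w with hμ
  set d : Fin n → ℝ := fun x => μ.real (openConn x b : Set (BondConfig (Fin n)))ᶜ with hd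
  have hd0 : ∀ x, 0 ≤ d x := fun x => measureReal_nonneg
  by_cases hA2 : A.card ≤ 2
  · exact CondGluing.kozmaNitzan_conjecture1_card_le_two w A o b hA2 t ht
  have hA3 : A.card = 3 := by omega
  have hU1 : μ.real (⋃ a ∈ A, (openConn o a : Set (BondConfig (Fin n)))) ≤ 1 := measureReal_le_one
  -- nonpositive `t`: trivial
  by_cases ht0 : t ≤ 0
  · exact (mul_nonpos_iff.2 (Or.inl ⟨measureReal_nonneg, ht0⟩)).trans measureReal_nonneg
  push Not at ht0
  -- coincidences
  by_cases hob : o = b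
  · subst hob
    have hself : μ.real (openConn o o : Set (BondConfig (Fin n))) = 1 := by
      have : (openConn o o : Set (BondConfig (Fin n))) = Set.univ := by ext ω; simp [openConn]
      rw [this, probReal_univ]
    obtain ⟨x, y, z, _, _, _, hAxyz⟩ := Finset.card_eq_three.1 hA3
    have htx : t ≤ 1 := (ht x (by rw [hAxyz]; simp)).trans measureReal_le_one
    rw [hself]
    calc μ.real (⋃ a ∈ A, (openConn o a : Set (BondConfig (Fin n)))) * t ≤ 1 * t :=
          mul_le_mul_of_nonneg_right hU1 ht0.le
      _ ≤ 1 := by linarith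
  by_cases hoA : o ∈ A
  · calc μ.real (⋃ a ∈ A, (openConn o a : Set (BondConfig (Fin n)))) * t ≤ 1 * t :=
          mul_le_mul_of_nonneg_right hU1 ht0.le
      _ ≤ μ.real (openConn o b : Set (BondConfig (Fin n))) := by rw [one_mul]; exact ht o hoA
  by_cases hbA : b ∈ A
  · -- through `COND` for the two relays other than `b`
    have hU : ((openConn o b : Set (BondConfig (Fin n)))ᶜ ∩ ⋃ a ∈ A, openConn o a) =
        (openConn o b : Set (BondConfig (Fin n)))ᶜ ∩ ⋃ a ∈ A.erase b, openConn o a := by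
      ext ω
      simp only [Set.mem_inter_iff, Set.mem_compl_iff, Set.mem_iUnion, Finset.mem_erase, exists_prop]
      constructor
      · rintro ⟨hnb, a, ha, hω⟩
        refine ⟨hnb, a, ⟨?_, ha⟩, hω⟩
        rintro rfl; exact hnb hω
      · rintro ⟨hnb, a, ⟨_, ha⟩, hω⟩; exact ⟨hnb, a, ha, hω⟩
    have hne : (A.erase b).Nonempty := by
      rw [← Finset.card_pos, Finset.card_erase_of_mem hbA]; omega
    obtain ⟨a', ha', hmax⟩ := Finset.exists_max_image (A.erase b) d hne
    have hcard : (A.erase b).card ≤ 2 := by rw [Finset.card_erase_of_mem hbA]; omega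
    have h2 := CondGluing.condGluing_card_le_two w (A.erase b) o b a' hcard ha' hmax
    have hcond : μ.real ((openConn o b : Set (BondConfig (Fin n)))ᶜ ∩ ⋃ a ∈ A, openConn o a) ≤
        μ.real (⋃ a ∈ A, (openConn o a : Set (BondConfig (Fin n)))) * d a' := by
      rw [hU]
      refine h2.trans (mul_le_mul_of_nonneg_right ?_ (hd0 _))
      exact measureReal_mono (Set.biUnion_subset_biUnion_left fun a ha => Finset.mem_of_mem_erase ha) (measure_ne_top _ _)
    exact CondGluing.kozmaNitzan_conjecture1_of_condGluing_at w A o b a' (Finset.mem_of_mem_erase ha') hcond t ht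
  -- general position
  obtain ⟨x, y, z, hxy, hxz, hyz, hAxyz⟩ := Finset.card_eq_three.1 hA3
  have hx : x ∈ A := by rw [hAxyz]; simp
  have hy : y ∈ A := by rw [hAxyz]; simp
  have hz : z ∈ A := by rw [hAxyz]; simp
  have h01 : o ≠ x := fun h => hoA (h ▸ hx)
  have h02 : o ≠ y := fun h => hoA (h ▸ hy)
  have h03 : o ≠ z := fun h => hoA (h ▸ hz)
  have h14 : x ≠ b := fun h => hbA (h ▸ hx)
  have h24 : y ≠ b := fun h => hbA (h ▸ hy)
  have h34 : z ≠ b := fun h => hbA (h ▸ hz)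
  rw [hAxyz, biUnion_three]
  exact kn_three_of_cert C hvalid hxs hnb hcheck hterm w o x y z b h01 h02 h03 hob hxy hxz h14 hyz h24 h34 t (ht x hx) (ht y hy) (ht z hz)

end CondCert

end Summit.CriticalPhenomena.PercolationContinuityZ3.Theorems

end
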